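import Mathlib
import Summits.ValiantsHypothesis.ValiantsHypothesis.Theorems.TwoProducts.Negative.RaySplitResidual
import Summits.ValiantsHypothesis.ValiantsHypothesis.Theorems.TwoProducts.Negative.RealizableDissociationSizeMismatch
import HarnessLib

/-!
# NEGATIVE lane (val-neg-1 g9): the v24/v25 hatches (R12 shifted carrier, R13♯ realizable tower) excise nothing up to padding —
in PLAIN cell currency the post-R13♯ residual law (level `C`) is `PlanarCellBound` again

Helper file for crux `stmt-ValiantsHypothesis-5906` (filed `--supports`; closes NO item, proves NO summit statement, does NOT prove
`TwoProducts`, `PlanarCellBound`, `ResidualLawV23/V24/V25`, any rung law or VP ≠ VNP; 0 `def`s).  Sequel to ✓ `Negative/RaySplitResidual.lean`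
(val-neg-1 g5, p662518) and ✓ `Negative/RealizableDissociationSizeMismatch.lean` (this seat).

`relation_ladder` v24/v25 (`Cruxes/TwoProducts/Lines/relation_ladder.lean`, `ResidualLawV24` / `ResidualLawV25`) add to the v23 residual two hatches —
R12 `¬ ∃ n x d, (tail alphabet ⊆ X ⊔ (X+d)) ∧ MomentRecord.CarrierDissociated x d m` and R13♯ `¬ ∃ n x d E, TowerRecord.Lift.TowerAlphabet u v x d E ∧
TowerRecord.TowerDissociatedE x d m E` — and change the cell currency to SUBMERGED families (K4).  THIS FILE, for the PLAIN currency `IsCellFamily`: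
for every fixed `C`, the law «v23 hypotheses at level `C` (texts of p662518: `ClassCover`/`HasDatum` unfolded, `R10Defs.*`/`RaySplit.*` by name) ∧ ¬R12 ∧ ¬R13♯
(BY NAME, token-for-token the two hatch clauses of `ResidualLawV25`) ⇒ cell bound» implies `PlanarCellBound` (`planarCellBound_of_residualV25Plain`), hence is
EQUIVALENT to it (`residualV25Plain_iff_planarCellBound`, fixed `C`; no `∃ C` theorem and no `↔ ResidualLawV25`).  Mechanism = p662518's padded instance
verbatim (directions padding, binary tower, full base-5 padding); the two new hatches are discharged by `SizeMismatch.shiftedHatch_false_of_double` /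
`towerHatch_false_of_double` on the DOUBLING PAIR `2•s₁, 4•s₁` of the first base-5 gadget (`fullPadding_letters`), which lies in the final tail support.
Exponents as in p662518: `(a, b) ↦ (a(18C+27), b + a(2(576C+608) + 18(C+1)(C+36)) + a(18C+27)(C+1))`.
HONEST LABEL: this is the PLAIN-currency reading only — the typed `ResidualLawV25` quantifies over `Submerged.IsSubmergedCellFamily`, and the deep
gadgets of the padding are NOT known to keep a family submerged; for the typed law the label of record stays the line's own cone
(`ResidualLawV25 → planarCellBound_v25`, by the proved rungs) + the trivial converse.  READING: like R8–R11, the R12/R13♯ hatches are proper positive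
sub-cases whose complement is co-final under padding; no instance class is removed from what the line owes.  [folklore]
-/

namespace Summit.ValiantsHypothesis.Theorems.TwoProducts.Negative.ResidualV25Plain

open Finset MvPolynomial
open Summit.ValiantsHypothesis.ValiantsHypothesis.Theorems.NewtonUnitEquations.TwoProducts.FormalLogLinearisation
open Summit.ValiantsHypothesis.ValiantsHypothesis.Theorems.NewtonUnitEquations.TwoProducts.PlanarCell
open Summit.ValiantsHypothesis.ValiantsHypothesis.Theorems.NewtonUnitEquations.TwoProducts.PermutationType
open Summit.ValiantsHypothesis.ValiantsHypothesis.Theorems.NewtonUnitEquations.TwoProducts.RaySplit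
open Summit.ValiantsHypothesis.ValiantsHypothesis.Theorems.NewtonUnitEquations.TwoProducts.MomentRecord (shiftZ CarrierDissociated)
open Summit.ValiantsHypothesis.ValiantsHypothesis.Theorems.NewtonUnitEquations.TwoProducts.TowerRecord (TowerDissociatedE)
open Summit.ValiantsHypothesis.ValiantsHypothesis.Theorems.NewtonUnitEquations.TwoProducts.TowerRecord.Lift (TowerAlphabet)
open Summit.ValiantsHypothesis.ValiantsHypothesis.Theorems.NewtonUnitEquations.TwoProducts.Negative.SizeMismatch
  (shiftedHatch_false_of_double towerHatch_false_of_double)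
open Summit.ValiantsHypothesis.Theorems.TwoProducts.Negative.CommonPadding
open Summit.ValiantsHypothesis.Theorems.TwoProducts.Negative.FullPadding (fullPadding_spec fullPadding_letters fullPadding_noDatum)
open Summit.ValiantsHypothesis.Theorems.TwoProducts.Negative.FullPaddingThresholds (fullPadding_noSmallPermMerge fullPadding_noCheapCover)
open Summit.ValiantsHypothesis.Theorems.TwoProducts.Negative.FullPaddingResidual (fullPadding_condition)
open Summit.ValiantsHypothesis.Theorems.TwoProducts.Negative.TowerPadding
open Summit.ValiantsHypothesis.Theorems.TwoProducts.Negative.TowerPaddingResidual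
  (tower_threshold tower_cost tower_pos_ne two_le_two_pow_succ)
open Summit.ValiantsHypothesis.Theorems.TwoProducts.Negative.DirectionsPadding (directions_padding not_raySplit_of_directions)
open Summit.ValiantsHypothesis.Theorems.TwoProducts.Negative.RaySplitResidual (directions_cost)

variable {m : ℕ}

/-- A letter at some position is a tail letter. [folklore] -/
theorem mem_tailSupport_of_mem_union {u v : Fin m → MvPolynomial (Fin 2) ℂ} {j : Fin m} {e : Expo}
    (h : e ∈ (u j).support ∪ (v j).support) : e ∈ tailSupport u v := by
  rw [tailSupport, Finset.mem_union]
  rcases Finset.mem_union.mp h with h | h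
  · exact Or.inl (Finset.mem_biUnion.mpr ⟨j, Finset.mem_univ _, h⟩)
  · exact Or.inr (Finset.mem_biUnion.mpr ⟨j, Finset.mem_univ _, h⟩)

/-- **The post-R13♯ residual law in PLAIN cell currency (level `C`) implies `PlanarCellBound`.** [folklore] -/
theorem planarCellBound_of_residualV25Plain (C : ℕ)
    (h : ∃ a b : ℕ, ∀ (m t : ℕ), 2 ≤ t → ∀ (u v : Fin m → MvPolynomial (Fin 2) ℂ),
      (∀ j, coeff 0 (u j) = 0 ∧ (u j).support.card ≤ t) → (∀ j, coeff 0 (v j) = 0 ∧ (v j).support.card ≤ t) →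
      (∀ (J : Finset (Fin m)) (j₀ : Fin m), j₀ ∈ J →
        BlockSmall (fun j => (u j).support ∪ (v j).support) J (2 ^ m * (t + 2) ^ 4) →
        ¬ PermType (mergeA (fun j => (u j).support ∪ (v j).support) J j₀)) →
      (∀ (r : ℕ) (Jc : Fin r → Finset (Fin m)) (ac bc : Fin r → Fin m → Expo),
        (∀ a ∈ tuples (fun j => (u j).support ∪ (v j).support), ∀ b ∈ tuples (fun j => (u j).support ∪ (v j).support),
          a ≠ b → ∑ j, a j = ∑ j, b j →
          ∃ k : Fin r, (∀ j, a j ≠ b j ↔ j ∈ Jc k) ∧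
            ((∀ j ∈ Jc k, a j = ac k j ∧ b j = bc k j) ∨ (∀ j ∈ Jc k, a j = bc k j ∧ b j = ac k j))) →
        2 ^ m * (t + 2) ^ 4 < 2 * (m + 1) * (3 * (2 + m + m.choose 2) ^ 2) ^ r) →
      (¬ ∃ ρp ρm : Expo →₀ ℕ, RankOneCoincidences (fun j => (u j).support ∪ (v j).support) ρp ρm) →
      (¬ ∃ L : Finset Expo, L.card ≤ C * m ∧
          R10Defs.LetterConfined (fun j => (u j).support ∪ (v j).support) L ∧
          R10Defs.FibreSpread (fun j => (u j).support ∪ (v j).support) L ((m + 2) ^ C)) →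
      (¬ ∃ K : ℕ, K ≤ C ∧ ∃ (g : Fin K → Expo) (ι : Expo → Fin K) (ν : Expo → ℕ), IndepRays g ∧
          OnRays g ι ν (tailSupport u v) ∧ RayCrossFree ι (fun j => (u j).support ∪ (v j).support)) →
      (¬ ∃ (n : ℕ) (x : Fin n → Expo) (d : Fin 2 → ℤ),
          (∀ e ∈ tailSupport u v, ∃ i, e = x i ∨ ∀ c, ((e c : ℕ) : ℤ) = shiftZ x d i c) ∧ CarrierDissociated x d m) →
      (¬ ∃ (n : ℕ) (x : Fin n → Expo) (d : Fin 2 → ℤ) (E : Finset ℕ), TowerAlphabet u v x d E ∧ TowerDissociatedE x d m E) →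
      ∀ (R : Expo → Expo → Prop) (S : Finset Expo), IsCellFamily u v R S → S.card ≤ 2 ^ (a * m) * (t + 2) ^ b) :
    ∃ a b : ℕ, ∀ (m t : ℕ), 2 ≤ t → ∀ (u v : Fin m → MvPolynomial (Fin 2) ℂ),
      (∀ j, coeff 0 (u j) = 0 ∧ (u j).support.card ≤ t) → (∀ j, coeff 0 (v j) = 0 ∧ (v j).support.card ≤ t) →
      ∀ (R : Expo → Expo → Prop) (S : Finset Expo),
        (∀ l ∈ S, ∃ ξ : Fin 2 → ℝ, ValidWeight u v ξ ∧ IsStrictTop ξ (logSupport u v) l ∧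
          ∀ e ∈ ((Finset.univ.biUnion fun j => (u j).support) ∪ Finset.univ.biUnion fun j => (v j).support),
          ∀ e' ∈ ((Finset.univ.biUnion fun j => (u j).support) ∪ Finset.univ.biUnion fun j => (v j).support),
            (R e e' ↔ wt ξ e ≤ wt ξ e')) →
        S.card ≤ 2 ^ (a * m) * (t + 2) ^ b := by
  classical
  obtain ⟨a, b, h⟩ := h
  refine ⟨a * (18 * C + 27), b + a * (2 * (576 * C + 608) + 18 * (C + 1) * (C + 36)) + a * (18 * C + 27) * (C + 1),
    fun m t ht u v hu hv R S hS => ?_⟩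
  change IsCellFamily u v R S at hS
  rcases S.eq_empty_or_nonempty with rfl | hne
  · simp
  -- step 0: `C+1` deep common monomial factors in pairwise non-parallel directions
  obtain ⟨w₀, R₀, hu₀, hv₀, hS₀, -, d, hdmem, hdnp⟩ := directions_padding C (by omega) u v hu hv R S hS hne
  obtain ⟨u₀, hu₀def⟩ : ∃ u₀ : Fin (m + (C + 1)) → MvPolynomial (Fin 2) ℂ, u₀ = Fin.append u w₀ := ⟨_, rfl⟩
  obtain ⟨v₀, hv₀def⟩ : ∃ v₀ : Fin (m + (C + 1)) → MvPolynomial (Fin 2) ℂ, v₀ = Fin.append v w₀ := ⟨_, rfl⟩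
  rw [← hu₀def] at hu₀ hS₀ hdmem
  rw [← hv₀def] at hv₀ hS₀ hdmem
  have hT := tailSupport_nonempty_of_isCellFamily hS₀ hne
  have hs0 := tailSum_ne_zero (fun j => (hu₀ j).1) (fun j => (hv₀ j).1) hT
  obtain ⟨Lg, hLg⟩ : ∃ Lg, Lg = Nat.log 2 (t + 2) := ⟨_, rfl⟩
  obtain ⟨z₀, hz₀⟩ : ∃ z₀, z₀ = m + (C + 1) + 32 * (Lg + 1) + 36 + C := ⟨_, rfl⟩
  obtain ⟨H, hH⟩ : ∃ H, H = (C + 1) * z₀ := ⟨_, rfl⟩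
  have hH1 : 1 ≤ H := by
    have : 0 < (C + 1) * z₀ := Nat.mul_pos (Nat.succ_pos C) (by omega)
    omega
  have hlt : t + 2 < 2 ^ (Lg + 1) := by rw [hLg]; exact Nat.lt_pow_succ_log_self (by norm_num) _
  have hle : 2 ^ Lg ≤ t + 2 := by rw [hLg]; exact Nat.pow_log_le_self 2 (by omega)
  -- step 1: the common binary tower
  have hc2 : ∀ i : Fin H, 2 ≤ (fun i : Fin H => 2 ^ ((i : ℕ) + 1)) i := fun i => two_le_two_pow_succ i
  have hc0 : ∀ i : Fin H, (fun i : Fin H => 2 ^ ((i : ℕ) + 1)) i ≠ 0 := fun i => by have := hc2 i; simp only at this ⊢; omega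
  obtain ⟨y, hy⟩ : ∃ y : Fin H → MvPolynomial (Fin 2) ℂ, y = fun i : Fin H =>
      monomial ((fun i : Fin H => 2 ^ ((i : ℕ) + 1)) i • ∑ f ∈ tailSupport u₀ v₀, f) (1 : ℂ) +
        monomial ((2 * (fun i : Fin H => 2 ^ ((i : ℕ) + 1)) i) • ∑ f ∈ tailSupport u₀ v₀, f) 1 := ⟨_, rfl⟩
  obtain ⟨hu₁, hv₁, -, -, -, hcell₁⟩ := scaledPadding_spec ht _ hc2 u₀ v₀ hu₀ hv₀ hT y hy
  obtain ⟨R₁, hS₁⟩ := hcell₁ R₀ S hS₀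
  have hlet := scaledPadding_letters (m := m + (C + 1)) _ hc0 u₀ v₀ hs0 y hy
  obtain ⟨u₁, hu₁def⟩ : ∃ u₁ : Fin (m + (C + 1) + (H + H)) → MvPolynomial (Fin 2) ℂ, u₁ = Fin.append u₀ (Fin.append y y) := ⟨_, rfl⟩
  obtain ⟨v₁, hv₁def⟩ : ∃ v₁ : Fin (m + (C + 1) + (H + H)) → MvPolynomial (Fin 2) ℂ, v₁ = Fin.append v₀ (Fin.append y y) := ⟨_, rfl⟩
  rw [← hu₁def] at hu₁ hS₁ hlet
  rw [← hv₁def] at hv₁ hS₁ hlet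
  have hT₁ := tailSupport_nonempty_of_isCellFamily hS₁ hne
  have hs₁ := tailSum_ne_zero (fun j => (hu₁ j).1) (fun j => (hv₁ j).1) hT₁
  -- step 2: the full base-5 padding of the towered instance
  obtain ⟨k, hk⟩ : ∃ k, k = (m + (C + 1) + (H + H)) + 4 * (Lg + 1) := ⟨_, rfl⟩
  have hC := fullPadding_condition hlt hk
  have hg2 : 2 ≤ 4 * k := by omega
  obtain ⟨z, hz⟩ : ∃ z : Fin (4 * k) → MvPolynomial (Fin 2) ℂ, z = fun i : Fin (4 * k) =>
      monomial ((2 * 5 ^ (i : ℕ)) • ∑ f ∈ tailSupport u₁ v₁, f) (1 : ℂ) +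
        monomial ((2 * (2 * 5 ^ (i : ℕ))) • ∑ f ∈ tailSupport u₁ v₁, f) 1 := ⟨_, rfl⟩
  obtain ⟨hu', hv', -, -, -, hcell'⟩ := fullPadding_spec ht u₁ v₁ hu₁ hv₁ hT₁ z hz
  obtain ⟨R', hS'⟩ := hcell' R₁ S hS₁
  have hnd := (fullPadding_noDatum u₁ v₁ hs₁ hg2 z hz).2
  -- the tower letters survive in the final family
  have hpq : ∀ i : Fin H, (Fin.castAdd (4 * k + 4 * k) (Fin.natAdd (m + (C + 1)) (Fin.castAdd H i)) : Fin (m + (C + 1) + (H + H) + (4 * k + 4 * k))) ≠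
      Fin.castAdd (4 * k + 4 * k) (Fin.natAdd (m + (C + 1)) (Fin.natAdd H i)) := tower_pos_ne hH1
  have htw : ∀ i : Fin H,
      2 ^ ((i : ℕ) + 1) • ∑ f ∈ tailSupport u₀ v₀, f ∈
        (Fin.append u₁ (Fin.append z z) (Fin.castAdd (4 * k + 4 * k) (Fin.natAdd (m + (C + 1)) (Fin.castAdd H i)))).support ∪
          (Fin.append v₁ (Fin.append z z) (Fin.castAdd (4 * k + 4 * k) (Fin.natAdd (m + (C + 1)) (Fin.castAdd H i)))).support ∧
      (2 * 2 ^ ((i : ℕ) + 1)) • ∑ f ∈ tailSupport u₀ v₀, f ∈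
        (Fin.append u₁ (Fin.append z z) (Fin.castAdd (4 * k + 4 * k) (Fin.natAdd (m + (C + 1)) (Fin.castAdd H i)))).support ∪
          (Fin.append v₁ (Fin.append z z) (Fin.castAdd (4 * k + 4 * k) (Fin.natAdd (m + (C + 1)) (Fin.castAdd H i)))).support ∧
      2 ^ ((i : ℕ) + 1) • ∑ f ∈ tailSupport u₀ v₀, f ∈
        (Fin.append u₁ (Fin.append z z) (Fin.castAdd (4 * k + 4 * k) (Fin.natAdd (m + (C + 1)) (Fin.natAdd H i)))).support ∪
          (Fin.append v₁ (Fin.append z z) (Fin.castAdd (4 * k + 4 * k) (Fin.natAdd (m + (C + 1)) (Fin.natAdd H i)))).support := by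
    intro i
    simp only [Fin.append_left]
    exact ⟨(hlet i).1.1, (hlet i).1.2, (hlet i).2.1⟩
  -- the direction letters survive in the final family
  have hsub₁ : tailSupport u₀ v₀ ⊆ tailSupport u₁ v₁ := by
    rw [hu₁def, hv₁def, tailSupport_append]; exact Finset.subset_union_left
  have hsub' : tailSupport u₁ v₁ ⊆ tailSupport (Fin.append u₁ (Fin.append z z)) (Fin.append v₁ (Fin.append z z)) := by
    rw [tailSupport_append]; exact Finset.subset_union_left
  -- NEW (v24/v25): the first base-5 gadget plants the DOUBLING PAIR `2•s₁, 2•(2•s₁)` in the final tail support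
  have hm2 : 2 ≤ m + (C + 1) + (H + H) + (4 * k + 4 * k) := by omega
  have hgl := (fullPadding_letters u₁ v₁ hs₁ z hz ⟨0, by omega⟩).1
  have hℓ : (2 * 5 ^ ((⟨0, by omega⟩ : Fin (4 * k)) : ℕ)) • ∑ f ∈ tailSupport u₁ v₁, f ∈
      tailSupport (Fin.append u₁ (Fin.append z z)) (Fin.append v₁ (Fin.append z z)) := mem_tailSupport_of_mem_union hgl.1
  have h2ℓ : 2 • ((2 * 5 ^ ((⟨0, by omega⟩ : Fin (4 * k)) : ℕ)) • ∑ f ∈ tailSupport u₁ v₁, f) ∈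
      tailSupport (Fin.append u₁ (Fin.append z z)) (Fin.append v₁ (Fin.append z z)) := by
    rw [smul_smul]
    exact mem_tailSupport_of_mem_union hgl.2
  -- apply the law to the final instance
  exact (h (m + (C + 1) + (H + H) + (4 * k + 4 * k)) t ht _ _ hu' hv'
    (fullPadding_noSmallPermMerge (t := t) _ hs₁ (fullPadding_letters u₁ v₁ hs₁ z hz) hC)
    (fullPadding_noCheapCover (t := t) _ hs₁ (fullPadding_letters u₁ v₁ hs₁ z hz) hC)
    (not_exists.2 fun ρp => not_exists.2 fun ρm => hnd ρp ρm)
    (fun ⟨L, _, hLc, hLf⟩ => tower_not_fibreSpread _ hs0 _ _ hpq htw hH1 L hLc _ (tower_threshold hz₀ hH rfl hk) hLf)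
    (not_raySplit_of_directions _ _ d (fun i => hsub' (hsub₁ (hdmem i))) hdnp)
    (shiftedHatch_false_of_double hm2 _ hℓ h2ℓ)
    (towerHatch_false_of_double hm2 _ hℓ h2ℓ)
    R' S hS').trans ((tower_cost a b hz₀ hH rfl hk hle (by omega)).trans (directions_cost _ _ m C t (by omega)))

/-- **Post-R13♯ residual law in plain currency (level `C`) ⇔ `PlanarCellBound`** as `∃ a b` laws. [folklore] -/
theorem residualV25Plain_iff_planarCellBound (C : ℕ) :
    (∃ a b : ℕ, ∀ (m t : ℕ), 2 ≤ t → ∀ (u v : Fin m → MvPolynomial (Fin 2) ℂ),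
      (∀ j, coeff 0 (u j) = 0 ∧ (u j).support.card ≤ t) → (∀ j, coeff 0 (v j) = 0 ∧ (v j).support.card ≤ t) →
      (∀ (J : Finset (Fin m)) (j₀ : Fin m), j₀ ∈ J →
        BlockSmall (fun j => (u j).support ∪ (v j).support) J (2 ^ m * (t + 2) ^ 4) →
        ¬ PermType (mergeA (fun j => (u j).support ∪ (v j).support) J j₀)) →
      (∀ (r : ℕ) (Jc : Fin r → Finset (Fin m)) (ac bc : Fin r → Fin m → Expo),
        (∀ a ∈ tuples (fun j => (u j).support ∪ (v j).support), ∀ b ∈ tuples (fun j => (u j).support ∪ (v j).support),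
          a ≠ b → ∑ j, a j = ∑ j, b j →
          ∃ k : Fin r, (∀ j, a j ≠ b j ↔ j ∈ Jc k) ∧
            ((∀ j ∈ Jc k, a j = ac k j ∧ b j = bc k j) ∨ (∀ j ∈ Jc k, a j = bc k j ∧ b j = ac k j))) →
        2 ^ m * (t + 2) ^ 4 < 2 * (m + 1) * (3 * (2 + m + m.choose 2) ^ 2) ^ r) →
      (¬ ∃ ρp ρm : Expo →₀ ℕ, RankOneCoincidences (fun j => (u j).support ∪ (v j).support) ρp ρm) →
      (¬ ∃ L : Finset Expo, L.card ≤ C * m ∧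
          R10Defs.LetterConfined (fun j => (u j).support ∪ (v j).support) L ∧
          R10Defs.FibreSpread (fun j => (u j).support ∪ (v j).support) L ((m + 2) ^ C)) →
      (¬ ∃ K : ℕ, K ≤ C ∧ ∃ (g : Fin K → Expo) (ι : Expo → Fin K) (ν : Expo → ℕ), IndepRays g ∧
          OnRays g ι ν (tailSupport u v) ∧ RayCrossFree ι (fun j => (u j).support ∪ (v j).support)) →
      (¬ ∃ (n : ℕ) (x : Fin n → Expo) (d : Fin 2 → ℤ),
          (∀ e ∈ tailSupport u v, ∃ i, e = x i ∨ ∀ c, ((e c : ℕ) : ℤ) = shiftZ x d i c) ∧ CarrierDissociated x d m) →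
      (¬ ∃ (n : ℕ) (x : Fin n → Expo) (d : Fin 2 → ℤ) (E : Finset ℕ), TowerAlphabet u v x d E ∧ TowerDissociatedE x d m E) →
      ∀ (R : Expo → Expo → Prop) (S : Finset Expo), IsCellFamily u v R S → S.card ≤ 2 ^ (a * m) * (t + 2) ^ b) ↔
    ∃ a b : ℕ, ∀ (m t : ℕ), 2 ≤ t → ∀ (u v : Fin m → MvPolynomial (Fin 2) ℂ),
      (∀ j, coeff 0 (u j) = 0 ∧ (u j).support.card ≤ t) → (∀ j, coeff 0 (v j) = 0 ∧ (v j).support.card ≤ t) →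
      ∀ (R : Expo → Expo → Prop) (S : Finset Expo),
        (∀ l ∈ S, ∃ ξ : Fin 2 → ℝ, ValidWeight u v ξ ∧ IsStrictTop ξ (logSupport u v) l ∧
          ∀ e ∈ ((Finset.univ.biUnion fun j => (u j).support) ∪ Finset.univ.biUnion fun j => (v j).support),
          ∀ e' ∈ ((Finset.univ.biUnion fun j => (u j).support) ∪ Finset.univ.biUnion fun j => (v j).support),
            (R e e' ↔ wt ξ e ≤ wt ξ e')) →
        S.card ≤ 2 ^ (a * m) * (t + 2) ^ b :=
  ⟨planarCellBound_of_residualV25Plain C,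
    fun ⟨a, b, h⟩ => ⟨a, b, fun m t ht u v hu hv _ _ _ _ _ _ _ R S hS => h m t ht u v hu hv R S hS⟩⟩

end Summit.ValiantsHypothesis.Theorems.TwoProducts.Negative.ResidualV25Plain
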